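import Literature.AlgebraicGeometry.Resolution.H0InvertibleTimesZeroDimensional
import Literature.AlgebraicGeometry.Morphisms.CechModuleSixTermLength
import HarnessLib

/-!
# `h⁰(𝒪/𝓘𝓚) + h¹(𝓘/𝓘𝓚) = h⁰(𝒪/𝓘) + h⁰(𝓘/𝓘𝓚)` on a resolution with `H¹(X, 𝒪_X) = 0`
# (Lipman 1969, §13: `χ(E + F) = χ(E) + χ(𝒪(−E)/𝒪(−E−F))`; the conormal tower `χ(nE)`)

Topic: `Literature/AlgebraicGeometry/Resolution`.  PROVED, fact-free, definition-free.  J. Lipman, *Rational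
singularities …*, Publ. Math. IHÉS 36 (1969), §13 (p. 223), computes `χ(E+F)` from the exact sequence
`0 → 𝒪(−E)/𝒪(−E−F) → 𝒪_{E+F} → 𝒪_E → 0`: `χ(E+F) = χ(E) + χ(𝒪(−E)/𝒪(−E−F))`.  On a resolution `π` of a
two-dimensional Noetherian local domain with `H¹(X, 𝒪_X) = 0` the two quotients of `𝒪_X` have `H¹ = 0`
(`Resolution/RationalResolutionSubschemeH1Vanishing`), so the additivity of the Čech Euler characteristic
(`Morphisms/CechModuleSixTermLength`) reads, for ANY ideal sheaves `𝓘`, `𝓚` and any finite affine open cover `𝒰`,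

  `h0 π (𝓘𝓚) + ℓ_T Ȟ¹(𝒰, 𝓘/𝓘𝓚) = h0 π 𝓘 + ℓ_T Γ(X, 𝓘/𝓘𝓚)`   (`𝓘/𝓘𝓚 := ker(𝒪/𝓘𝓚 → 𝒪/𝓘)`),

i.e. `χ(𝒪/𝓘𝓚) = χ(𝒪/𝓘) + χ(𝓘/𝓘𝓚)` with `χ(𝒪/𝓙) = h⁰(𝒪/𝓙)`.  For `𝓚 = 𝓘 = 𝓘_E` (or `𝓘 = 𝓘_E^n`) this is the
conormal tower `h⁰(𝒪_{(n+1)E}) − h⁰(𝒪_{nE}) = χ(𝓘_E^n/𝓘_E^{n+1})`, reducing the repeated-curve halves of Lipman's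
(13.1) b), d) in `h⁰`-form (`Lipman1969_13_1_b_rat`, `_d_rat` with `η = η′`) to the Euler characteristic of the
conormal powers on the integral exceptional curve `E` (Riemann–Roch on `E`: `χ(𝓘^n/𝓘^{n+1}) = h⁰(E) − n(E·E)`, NOT
proved here).

* **`IsResolution.h0_mul_add_length_cechMH1_kernel`** — the displayed identity.

## References
* J. Lipman, Publ. Math. IHÉS 36 (1969), §13 (p. 223), §10 (p. 212). [Lipman1969]
* R. Hartshorne, *Algebraic Geometry* (1977), III Thm. 4.5 proof (p. 222). [Hartshorne1977]
-/

noncomputable section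

-- `TopCat.Presheaf`/`Scheme.Modules` are not reducible (as in Mathlib's `AlgebraicGeometry/Modules`).
set_option backward.isDefEq.respectTransparency false

open CategoryTheory CategoryTheory.Limits AlgebraicGeometry TopologicalSpace IsLocalRing Opposite
open Literature.AlgebraicGeometry.Morphisms Literature.AlgebraicGeometry.Modules
open Scheme.IdealSheafData

universe u

namespace Literature.AlgebraicGeometry.Resolution

variable {A : Type u} [CommRing A] [IsNoetherianRing A] [IsLocalRing A] [IsDomain A]
  {X : Scheme.{u}} [IsIntegral X] [IsLocallyNoetherian X] (π : X ⟶ Spec (.of A))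

/-- **`h⁰(𝒪/𝓘𝓚) + ℓȞ¹(𝓘/𝓘𝓚) = h⁰(𝒪/𝓘) + ℓΓ(𝓘/𝓘𝓚)`** on a resolution of a two-dimensional Noetherian local domain
with `H¹(X, 𝒪_X) = 0`, for any ideal sheaves `𝓘`, `𝓚`, any map `q : 𝒪/𝓘𝓚 → 𝒪/𝓘` compatible with the projections, and
any finite affine open cover `𝒰` (the six-term Čech sequence of `0 → ker q → 𝒪/𝓘𝓚 → 𝒪/𝓘 → 0`, in which
`Ȟ¹(𝒪/𝓘𝓚) = Ȟ¹(𝒪/𝓘) = 0`). Lipman's `χ(E+F) = χ(E) + χ(𝒪(−E)/𝒪(−E−F))` with `χ(E+F) = h⁰`, `χ(E) = h⁰`.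
[cite: Lipman1969, Section 13 (p. 223)] [cite: Hartshorne1977, III Thm. 4.5 proof p. 222 (long exact sequence of Čech cohomology)] -/
theorem IsResolution.h0_mul_add_length_cechMH1_kernel (hA : ringKrullDim A = 2) (hπ : IsResolution π)
    (h1 : HasTrivialCechH1 π) (𝓘 𝓚 : X.IdealSheafData)
    (q : idealQuot (unitModule X) (𝓘 * 𝓚) ⟶ idealQuot (unitModule X) 𝓘)
    (hq : idealQuotπ (unitModule X) (𝓘 * 𝓚) ≫ q = idealQuotπ (unitModule X) 𝓘)
    {κ : Type u} [Finite κ] (U : κ → X.Opens) (hUaff : ∀ i, IsAffineOpen (U i)) (hUcov : ⨆ i, U i = ⊤) :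
    h0 π (𝓘 * 𝓚) + Module.length A (CechMH1 π (kernel q) U) =
      h0 π 𝓘 + Module.length A (MSections π (kernel q) ⊤) := by
  haveI : IsProper π := hπ.isProper
  have hT := shortExact_kernel_idealQuot 𝓘 𝓚 q hq
  have hK : IsAffineLocalizing (kernel q) :=
    IsAffineLocalizing.kernel q (isAffineLocalizing_idealQuot _ IsAffineLocalizing.unit)
      (isAffineLocalizing_idealQuot _ IsAffineLocalizing.unit)
  have hdata : CechExactData π U (kernel.ι q) q := CechExactData.of_shortExact π U hT hK hUaff
  -- `Ȟ¹(𝒪/𝓘) = 0`, so `Ȟ¹(𝒪/𝓘𝓚) → Ȟ¹(𝒪/𝓘)` is onto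
  have hH1I : Subsingleton (CechMH1 π (idealQuot (unitModule X) 𝓘) U) :=
    subsingleton_cechMH1_idealQuot_of_hasTrivialCechH1 π 𝓘 (hπ.hasTrivialCechH1_subschemeι_comp π hA h1 𝓘) U hUaff hUcov
  have hH1IK : Subsingleton (CechMH1 π (idealQuot (unitModule X) (𝓘 * 𝓚)) U) :=
    subsingleton_cechMH1_idealQuot_of_hasTrivialCechH1 π (𝓘 * 𝓚)
      (hπ.hasTrivialCechH1_subschemeι_comp π hA h1 (𝓘 * 𝓚)) U hUaff hUcov
  have hsurj : Function.Surjective (cechMapH1 π q U) := fun y => ⟨0, Subsingleton.elim _ _⟩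
  have hsix := CechExactData.length_cechMH0_add π U hdata hsurj
  -- the vanishing `Ȟ¹` terms and `Ȟ⁰ = Γ`
  have e1 : Module.length A (CechMH1 π (idealQuot (unitModule X) (𝓘 * 𝓚)) U) = 0 := Module.length_eq_zero
  have e2 : Module.length A (CechMH1 π (idealQuot (unitModule X) 𝓘) U) = 0 := Module.length_eq_zero
  rw [e1, e2, add_zero, add_zero, ← (cechMH0EquivSections π U (kernel q) hUcov).length_eq,
    ← (cechMH0EquivSections π U (idealQuot (unitModule X) 𝓘) hUcov).length_eq,
    ← (cechMH0EquivSections π U (idealQuot (unitModule X) (𝓘 * 𝓚)) hUcov).length_eq,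
    ← h0_eq_length_MSections_idealQuot, ← h0_eq_length_MSections_idealQuot] at hsix
  -- `hsix : ℓΓ(ker) + h0 𝓘 = h0 (𝓘𝓚) + ℓȞ¹(ker)`
  rw [← hsix, add_comm]

end Literature.AlgebraicGeometry.Resolution

end
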